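import Summits.AtomisticToContinuum.FouriersLaw.Theorems.EmbeddedDrudeMourreFGRGapBranchB
import Summits.AtomisticToContinuum.FouriersLaw.Theorems.EmbeddedDrudeMourreFGRGapBranchC
import Mathlib.MeasureTheory.Integral.IntervalIntegral.Periodic

/-!
# FGRGap, line `fold-jet-rigidity`: the registered stub `stub_branchStructure` (GA)

Crux `EmbeddedDrudeMourre.FGRGap` (item stmt-AtomisticToContinuum-12595), line fold-jet-rigidity,
stub `stub_branchStructure` — the TWO-ROOT STRUCTURE of the resonant set of the pinned band and its
partner map `h`, proved with exactly the registered signature from parts A–C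
(`…FGRGapBranchA/B/C`):

* parts A/B give a partner selector `h` with the elementary clauses (cell-valued, resonant, doubly
  `2π`-periodic, `h k k = k`, `resonantSet ω₂ k₁ k₃ = {k₃ mod 2π, h k₁ k₃}` off the diagonal,
  trivial iff `v(k₃) = v(k₁)`, `v(h) ≠ v(k₁ + h - k₃)` off that curve);
* part C (analytic implicit function theorem at the simple root `h k₁ k₃`) gives the local analytic
  lift `φ` with the implicit derivative; `φ ≡ h (mod 2π)` near the base point because `φ p` is
  resonant, not congruent to the exchange root `p.2` (by continuity, as `h k₁ k₃ ≢ k₃`), and the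
  resonant set has only the two classes (`selector_lift`);
* measurability (`selector_measurable`): `p ↦ (h p : ℝ/2πℤ)` is continuous off the closed
  equal-velocity curve (locally it is `φ mod 2π`) and equals `p.2 mod 2π` on it, hence is Borel;
  `h` is recovered through the measurable section `AddCircle.measurableEquivIoc`.
-/

noncomputable section

open MeasureTheory Set Real Filter Topology
open scoped ENNReal
open Literature.MathematicalPhysics.KineticTheory.PhononBoltzmann

namespace Summit.AtomisticToContinuum.FouriersLaw.Theorems.FGRGap.FoldJetRigidity.Branch

variable {ω₂ : ℝ}

/-- Congruent reals have the same image in `ℝ/2πℤ`. [folklore] -/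
theorem coe_addCircle_eq_of_modEq {x y : ℝ} (h : ∃ n : ℤ, y - x = n * (2 * π)) :
    ((y : ℝ) : AddCircle (2 * π)) = x := by
  obtain ⟨n, hn⟩ := h
  rw [← sub_eq_zero, ← AddCircle.coe_sub, AddCircle.coe_eq_zero_iff]
  exact ⟨n, by rw [zsmul_eq_mul, hn]⟩

/-- Reals with the same image in `ℝ/2πℤ` are congruent. [folklore] -/
theorem modEq_of_coe_addCircle_eq {x y : ℝ} (h : ((y : ℝ) : AddCircle (2 * π)) = x) :
    ∃ n : ℤ, y - x = n * (2 * π) := by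
  rw [← sub_eq_zero, ← AddCircle.coe_sub, AddCircle.coe_eq_zero_iff] at h
  obtain ⟨n, hn⟩ := h
  exact ⟨n, by rw [← hn, zsmul_eq_mul]⟩

/-- **The local analytic lift of a selector (clause (i) of GA).** Near a point off the
equal-velocity curve the selector `h` has a real-analytic lift `φ ≡ h (mod 2π)` with `φ = h` at the
point and the implicit derivatives `∂₁φ = (v₄-v₁)/(v₂-v₄)`, `∂₃φ = (v₃-v₄)/(v₂-v₄)`. [folklore] -/
theorem selector_lift (hω : 0 < ω₂) {h : ℝ → ℝ → ℝ}
    (H1 : ∀ k₁ k₃, h k₁ k₃ ∈ resonantSet ω₂ k₁ k₃)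
    (H3 : ∀ k₁ k₃, (∀ n : ℤ, k₃ - k₁ ≠ n * (2 * π)) → h k₁ k₃ = toIocMod Real.two_pi_pos (-π) k₃ →
      resonantSet ω₂ k₁ k₃ ⊆ {toIocMod Real.two_pi_pos (-π) k₃})
    {k₁ k₃ : ℝ} (hv : groupVelocity ω₂ k₃ ≠ groupVelocity ω₂ k₁) :
    ∃ (φ : ℝ × ℝ → ℝ) (U : Set (ℝ × ℝ)), U ∈ 𝓝 (k₁, k₃) ∧ AnalyticOnNhd ℝ φ U ∧
      φ (k₁, k₃) = h k₁ k₃ ∧ (∀ p ∈ U, ∃ n : ℤ, φ p = h p.1 p.2 + n * (2 * π)) ∧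
      (∀ p ∈ U, groupVelocity ω₂ p.2 ≠ groupVelocity ω₂ p.1) ∧
      (∀ p ∈ U, HasStrictFDerivAt φ
        (((groupVelocity ω₂ (p.1 + φ p - p.2) - groupVelocity ω₂ p.1) /
              (groupVelocity ω₂ (φ p) - groupVelocity ω₂ (p.1 + φ p - p.2))) •
            ContinuousLinearMap.fst ℝ ℝ ℝ +
          ((groupVelocity ω₂ p.2 - groupVelocity ω₂ (p.1 + φ p - p.2)) /
              (groupVelocity ω₂ (φ p) - groupVelocity ω₂ (p.1 + φ p - p.2))) •
            ContinuousLinearMap.snd ℝ ℝ ℝ) p) := by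
  obtain ⟨φ, hφ0, hφan, hφz, hφd⟩ :=
    exists_lift hω (H1 k₁ k₃).2 (selector_velocity_ne hω H1 H3 hv)
  have hvc := continuous_groupVelocity hω
  have e1 : ∀ᶠ p in 𝓝 (k₁, k₃), AnalyticAt ℝ φ p := hφan.eventually_analyticAt
  have e3 : ∀ᶠ p : ℝ × ℝ in 𝓝 (k₁, k₃), groupVelocity ω₂ p.2 ≠ groupVelocity ω₂ p.1 := by
    have hc : ContinuousAt (fun p : ℝ × ℝ => groupVelocity ω₂ p.2 - groupVelocity ω₂ p.1)
        (k₁, k₃) :=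
      ((hvc.comp continuous_snd).sub (hvc.comp continuous_fst)).continuousAt
    filter_upwards [hc.eventually_ne (sub_ne_zero.2 hv)] with p hp
    exact sub_ne_zero.1 hp
  have e5 : ∀ᶠ p : ℝ × ℝ in 𝓝 (k₁, k₃), ((φ p - p.2 : ℝ) : AddCircle (2 * π)) ≠ 0 := by
    have hc : ContinuousAt (fun p : ℝ × ℝ => ((φ p - p.2 : ℝ) : AddCircle (2 * π))) (k₁, k₃) :=
      (AddCircle.continuous_mk' (2 * π)).continuousAt.comp (hφan.continuousAt.sub continuousAt_snd)
    apply hc.eventually_ne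
    intro h0
    have hmod : ∃ n : ℤ, φ (k₁, k₃) - k₃ = n * (2 * π) := by
      have h0' : (((φ (k₁, k₃) - k₃ : ℝ) : AddCircle (2 * π))) = ((0 : ℝ) : AddCircle (2 * π)) :=
        h0
      simpa using modEq_of_coe_addCircle_eq h0'
    rw [hφ0] at hmod
    have ht := Generic.sub_ne_of_groupVelocity_ne hv
    have hne : h k₁ k₃ ≠ toIocMod Real.two_pi_pos (-π) k₃ := fun hh =>
      hv ((selector_trivial_iff hω H1 H3 ht).1 hh)
    apply hne
    apply eq_of_mem_cell (Generic.toIocMod_mem_cell k₃) (H1 k₁ k₃).1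
    obtain ⟨n, hn⟩ := hmod
    obtain ⟨a, ha⟩ := toIocMod_sub_eq_int k₃
    exact ⟨n - a, by push_cast; linarith⟩
  refine ⟨φ, {p | AnalyticAt ℝ φ p ∧ resonanceFn ω₂ p.1 (φ p) p.2 = 0 ∧
      groupVelocity ω₂ p.2 ≠ groupVelocity ω₂ p.1 ∧
      HasStrictFDerivAt φ
        (((groupVelocity ω₂ (p.1 + φ p - p.2) - groupVelocity ω₂ p.1) /
              (groupVelocity ω₂ (φ p) - groupVelocity ω₂ (p.1 + φ p - p.2))) •
            ContinuousLinearMap.fst ℝ ℝ ℝ +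
          ((groupVelocity ω₂ p.2 - groupVelocity ω₂ (p.1 + φ p - p.2)) /
              (groupVelocity ω₂ (φ p) - groupVelocity ω₂ (p.1 + φ p - p.2))) •
            ContinuousLinearMap.snd ℝ ℝ ℝ) p ∧
      ((φ p - p.2 : ℝ) : AddCircle (2 * π)) ≠ 0},
    e1.and (hφz.and (e3.and (hφd.and e5))), fun p hp => hp.1, hφ0, ?_, fun p hp => hp.2.2.1,
    fun p hp => hp.2.2.2.1⟩
  rintro p ⟨-, hz, hvp, -, hc⟩
  have ht := Generic.sub_ne_of_groupVelocity_ne hvp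
  have hmem := toIocMod_mem_resonantSet_of_zero hz
  rw [resonantSet_eq_pair hω H1 H3 ht] at hmem
  rcases hmem with hm | hm
  · exact absurd (coe_addCircle_eq_of_modEq (modEq_of_toIocMod_eq hm)) fun h0 =>
      hc (by rw [AddCircle.coe_sub, h0, sub_self])
  · obtain ⟨n, hn⟩ := Generic.exists_toIocMod_eq_add (-π) (φ p)
    exact ⟨-n, by rw [hm] at hn; push_cast; linarith⟩

/-- **Joint measurability of a selector (clause (h) of GA).** `p ↦ (h p : ℝ/2πℤ)` is continuous
off the closed equal-velocity curve (locally `= φ mod 2π`) and equals `p.2 mod 2π` on it, so it is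
Borel; `h = ` (measurable section `ℝ/2πℤ → (-π, π]`) `∘` (that map). [folklore] -/
theorem selector_measurable (hω : 0 < ω₂) {h : ℝ → ℝ → ℝ}
    (H1 : ∀ k₁ k₃, h k₁ k₃ ∈ resonantSet ω₂ k₁ k₃)
    (H2 : ∀ k₁ k₃, (∃ n : ℤ, k₃ - k₁ = n * (2 * π)) → h k₁ k₃ = toIocMod Real.two_pi_pos (-π) k₃)
    (H3 : ∀ k₁ k₃, (∀ n : ℤ, k₃ - k₁ ≠ n * (2 * π)) → h k₁ k₃ = toIocMod Real.two_pi_pos (-π) k₃ →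
      resonantSet ω₂ k₁ k₃ ⊆ {toIocMod Real.two_pi_pos (-π) k₃}) :
    Measurable (Function.uncurry h) := by
  haveI : Fact (0 < 2 * π) := ⟨two_pi_pos⟩
  have hvc := continuous_groupVelocity hω
  obtain ⟨C, hCdef⟩ : ∃ C : Set (ℝ × ℝ),
      C = {p : ℝ × ℝ | groupVelocity ω₂ p.2 = groupVelocity ω₂ p.1} := ⟨_, rfl⟩
  have hC : IsClosed C := hCdef ▸ isClosed_eq (hvc.comp continuous_snd) (hvc.comp continuous_fst)
  have honC : ∀ p ∈ C, h p.1 p.2 = toIocMod Real.two_pi_pos (-π) p.2 := by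
    intro p hp
    rw [hCdef] at hp
    by_cases hd : ∃ n : ℤ, p.2 - p.1 = n * (2 * π)
    · exact H2 _ _ hd
    · exact (selector_trivial_iff hω H1 H3 (fun n hn => hd ⟨n, hn⟩)).2 hp
  -- the circle-valued map is Borel
  have hΘ : Measurable fun p : ℝ × ℝ => ((h p.1 p.2 : ℝ) : AddCircle (2 * π)) := by
    refine measurable_of_restrict_of_restrict_compl hC.measurableSet ?_ ?_
    · have heq : C.restrict (fun p : ℝ × ℝ => ((h p.1 p.2 : ℝ) : AddCircle (2 * π))) =
          fun p : C => (((p : ℝ × ℝ).2 : ℝ) : AddCircle (2 * π)) := by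
        funext p
        rw [restrict_apply, honC p p.2]
        exact coe_addCircle_eq_of_modEq (toIocMod_sub_eq_int _)
      rw [heq]
      exact ((AddCircle.continuous_mk' (2 * π)).comp
        (continuous_snd.comp continuous_subtype_val)).measurable
    · apply Continuous.measurable
      rw [← continuousOn_iff_continuous_restrict]
      refine hC.isOpen_compl.continuousOn_iff.2 fun p hp => ?_
      have hp' : groupVelocity ω₂ p.2 ≠ groupVelocity ω₂ p.1 := by
        rw [hCdef] at hp
        exact hp
      obtain ⟨φ, U, hU, hφU, -, hcong, -, -⟩ := selector_lift hω H1 H3 hp'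
      have hφc : ContinuousAt φ p := (hφU p (mem_of_mem_nhds hU)).continuousAt
      refine ((AddCircle.continuous_mk' (2 * π)).continuousAt.comp hφc).congr ?_
      filter_upwards [hU] with q hq
      obtain ⟨n, hn⟩ := hcong q hq
      show (((φ q : ℝ)) : AddCircle (2 * π)) = ((h q.1 q.2 : ℝ) : AddCircle (2 * π))
      exact coe_addCircle_eq_of_modEq ⟨n, by rw [hn]; ring⟩
  -- recover `h` through the measurable section
  have hrep : Function.uncurry h = fun p : ℝ × ℝ =>
      ((AddCircle.measurableEquivIoc (2 * π) (-π) ((h p.1 p.2 : ℝ) : AddCircle (2 * π)) :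
        Ioc (-π) (-π + 2 * π)) : ℝ) := by
    funext p
    have hmem : h p.1 p.2 ∈ Ioc (-π) (-π + 2 * π) := by
      rw [show -π + 2 * π = π by ring]
      exact (H1 p.1 p.2).1
    have happ : (AddCircle.measurableEquivIoc (2 * π) (-π) ((h p.1 p.2 : ℝ) : AddCircle (2 * π)) :
        ℝ) = AddCircle.equivIoc (2 * π) (-π) ((h p.1 p.2 : ℝ) : AddCircle (2 * π)) := rfl
    rw [happ, AddCircle.equivIoc_coe_of_mem hmem]
    rfl
  rw [hrep]
  exact measurable_subtype_coe.comp ((AddCircle.measurableEquivIoc (2 * π) (-π)).measurable.comp hΘ)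

end Branch

open Branch in
/-- **GA — BRANCH STRUCTURE (two-root structure of the resonant set; the partner map `h`).**
For `ω₂ > 0` there is `h : ℝ → ℝ → ℝ` with: values in the cell `(-π, π]`; `Ω(k₁, h k₁ k₃, k₃) = 0`;
`2π`-periodic in each argument; `h k k = k` on the cell; OFF THE DIAGONAL (`k₃ - k₁ ∉ 2πℤ`) the
resonant set is `{k₃ mod 2π, h k₁ k₃}`; the branch is trivial iff `v(k₃) = v(k₁)` (equal group
velocity); off that curve `v(h) ≠ v(k₄)` (`k₄ = k₁ + h - k₃`); `h` is jointly measurable; and near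
every point with `v(k₃) ≠ v(k₁)` there is a real-analytic LIFT `φ ≡ h (mod 2π)`, `φ = h` at the
point, on a neighbourhood avoiding the equal-velocity curve, with the implicit derivative
`Dφ = ((v₄-v₁) dk₁ + (v₃-v₄) dk₃)/(v₂-v₄)`.
Proof: with `s = (k₃-k₁)/2`, `Ω(k₁,k₂,k₃) = E_s(k₂-s) - E_s((k₁+k₃)/2)`,
`E_s(y) = ω(y+s) - ω(y-s)`, and `E_s(y) = c` forces a QUADRATIC relation in `cos y` (part A): at
most two resonant classes, a degenerate zero is alone, a non-degenerate one has a partner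
(local-extremum argument); then the selector of part B, the analytic implicit function theorem of
part C, and the Borel section of `ℝ → ℝ/2πℤ` for measurability.
[AokiLukkarinenSpohn2006 §4 (4.3)-(4.8); Lukkarinen2016 §2.2.4] [folklore] -/
theorem stub_branchStructure :
    ∀ ω₂ : ℝ, 0 < ω₂ → ∃ h : ℝ → ℝ → ℝ,
      ((∀ k₁ k₃ : ℝ, h k₁ k₃ ∈ Set.Ioc (-π) π) ∧
        (∀ k₁ k₃ : ℝ, resonanceFn ω₂ k₁ (h k₁ k₃) k₃ = 0) ∧
        (∀ k₁ k₃ : ℝ, h (k₁ + 2 * π) k₃ = h k₁ k₃ ∧ h k₁ (k₃ + 2 * π) = h k₁ k₃) ∧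
        (∀ k : ℝ, k ∈ Set.Ioc (-π) π → h k k = k) ∧
        (∀ k₁ k₃ : ℝ, (∀ n : ℤ, k₃ - k₁ ≠ n * (2 * π)) →
          resonantSet ω₂ k₁ k₃ = {toIocMod Real.two_pi_pos (-π) k₃, h k₁ k₃}) ∧
        (∀ k₁ k₃ : ℝ, (∀ n : ℤ, k₃ - k₁ ≠ n * (2 * π)) →
          (h k₁ k₃ = toIocMod Real.two_pi_pos (-π) k₃ ↔ groupVelocity ω₂ k₃ = groupVelocity ω₂ k₁)) ∧
        (∀ k₁ k₃ : ℝ, groupVelocity ω₂ k₃ ≠ groupVelocity ω₂ k₁ →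
          groupVelocity ω₂ (h k₁ k₃) ≠ groupVelocity ω₂ (k₁ + h k₁ k₃ - k₃)) ∧
        Measurable (Function.uncurry h) ∧
        (∀ k₁ k₃ : ℝ, groupVelocity ω₂ k₃ ≠ groupVelocity ω₂ k₁ →
          ∃ (φ : ℝ × ℝ → ℝ) (U : Set (ℝ × ℝ)), U ∈ 𝓝 (k₁, k₃) ∧ AnalyticOnNhd ℝ φ U ∧
            φ (k₁, k₃) = h k₁ k₃ ∧ (∀ p ∈ U, ∃ n : ℤ, φ p = h p.1 p.2 + n * (2 * π)) ∧
            (∀ p ∈ U, groupVelocity ω₂ p.2 ≠ groupVelocity ω₂ p.1) ∧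
            (∀ p ∈ U, HasStrictFDerivAt φ (((groupVelocity ω₂ (p.1 + φ p - p.2) - groupVelocity ω₂ p.1) /
              (groupVelocity ω₂ (φ p) - groupVelocity ω₂ (p.1 + φ p - p.2))) • ContinuousLinearMap.fst ℝ ℝ ℝ +
            ((groupVelocity ω₂ p.2 - groupVelocity ω₂ (p.1 + φ p - p.2)) /
              (groupVelocity ω₂ (φ p) - groupVelocity ω₂ (p.1 + φ p - p.2))) • ContinuousLinearMap.snd ℝ ℝ ℝ) p))) := by
  intro ω₂ hω
  obtain ⟨h, H1, H2, H3⟩ := exists_selector ω₂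
  exact ⟨h, fun k₁ k₃ => (H1 k₁ k₃).1, fun k₁ k₃ => (H1 k₁ k₃).2, selector_periodic hω H1 H2 H3,
    fun k hk => selector_diag H2 hk, fun k₁ k₃ ht => resonantSet_eq_pair hω H1 H3 ht,
    fun k₁ k₃ ht => selector_trivial_iff hω H1 H3 ht,
    fun k₁ k₃ hv => selector_velocity_ne hω H1 H3 hv, selector_measurable hω H1 H2 H3,
    fun k₁ k₃ hv => selector_lift hω H1 H3 hv⟩

end Summit.AtomisticToContinuum.FouriersLaw.Theorems.FGRGap.FoldJetRigidity

end
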